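import Literature.AlgebraicGeometry.Motives.JacobianBrillNoetherLocusPoints
import Literature.AlgebraicGeometry.Motives.JacobianAbelJacobiSum
import Literature.AlgebraicGeometry.Motives.WeilJacobianDimension
import Literature.AlgebraicGeometry.Motives.CurveSignedFamilies
import Literature.AlgebraicGeometry.Motives.CurveUniversalDivisor
import Literature.AlgebraicGeometry.Motives.CartierDivisorProperTrivial
import Literature.AlgebraicGeometry.Motives.VarietiesGeometricallyIntegralProofs
import Literature.AlgebraicGeometry.Motives.VarietiesProperProofs
import Literature.AlgebraicGeometry.HodgeTheory.CurveHodgeGenusBound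
import Literature.AlgebraicGeometry.HodgeTheory.AlgebraicityLocusWitnesses
import Literature.NumberTheory.DiophantineGeometry.FunctionFieldDivisorsNegativeDegreeProofs
import Literature.NumberTheory.Transcendental.AnalytificationConnected
import Literature.AlgebraicGeometry.Motives.AbelTheorem
import Literature.AlgebraicGeometry.Motives.AbelianVarietyBlochFiltrationTransfer
import HarnessLib

/-!
# `W̃_{g−1}(P)` is symmetric up to translation: `[−1]⁻¹ W̃_{g−1} = t_κ⁻¹ W̃_{g−1}` (Riemann–Roch)

Layer `Literature/AlgebraicGeometry/Motives`, namespace `Literature.AlgebraicGeometry.Motives.Jacobian` (dot notation on the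
tree's `Motives.Jacobian C`).  KERNEL ONLY: theorems, no definition, no named fact, no instance, no `sorry`.  Sequel of ★
`Motives/JacobianBrillNoetherLocusPoints` (`pt_mem_brillNoetherLocus_iff`: the `k`-points of `W̃_r(P)` are the sums `Σ_{i<r} f^P(τᵢ)`)
and ★ `Motives/JacobianAbelJacobiSum` (`aj_c`).

## The mathematics ([Lange2023AbelianVarietiesComplex] §4.2.2 (Riemann's theorem, `W_{g−1}` and `K_C − D`), [Milne1986JacobianVarieties] §5–§6, [Hartshorne1977] IV.1 Thm. 1.3)

Let `C/ℂ` be a smooth projective curve of genus `g`, `𝒥` a Jacobian (`dim J = g`), `P ∈ C(ℂ)`, `f = f^P : C → J` and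
`W̃ = W̃_{g−1}(P) = {Σ_{i<g−1} f(τᵢ)}⁻ ⊆ J`.  For an effective divisor `D = Σ_{i<g−1}[τᵢ]` of degree `g − 1` Riemann–Roch gives
`ℓ(K_C − D) = h⁰(D) ≥ 1`, so `K_C − D ∼ D′` with `D′ = Σ_{i<g−1}[τ′ᵢ]` effective; by Abel's theorem (taken here as the HYPOTHESIS
`hlin : D ∼ E → aj_P(D) = aj_P(E)`, letter (g4-1e) of the cell) `aj_P(D′) · aj_P(D) = κ := aj_P` of any one such pair.  Hence on
`ℂ`-points **`x⁻¹ ∈ W̃ ⟺ κ·x ∈ W̃`**, and since both `[−1]⁻¹ W̃` and `t_κ⁻¹ W̃` are Zariski closed in the Jacobson scheme `J`, they are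
EQUAL: `W̃_{g−1}` is symmetric up to the translation by `κ = [K_C − (2g−2)P]` (print: `(−1)^* W_{g−1} = W_{g−1}` in `Pic^{g−1}`, the
first step of Riemann's theorem on symmetric theta divisors).

## What is proved (letters (SYM) of the cell `hodgecm-mathlib`, road G4 (3a), pen A-p04 (g17) ruling #6 (c))
§1 `ajSum_sumDivisor_pointDivisor` (`aj_P(Σᵢ[τᵢ]) = ∏ᵢ f^P(τᵢ)`); §2 the function-field divisor of `Σᵢ[τᵢ]` (a sum of `r` places, effective
of degree `r`) and conversely every effective divisor of degree `r` of `ℂ(C)` is of this form; §3 the bridge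
`linEquiv_of_isLinearlyEquivalent_toDivisor` (linear equivalence of the function-field divisors ⇒ linear equivalence of the Cartier
divisors, via ★ `linEquiv_of_isSection_sub`); §4 the Riemann–Roch step and the key `exists_forall_tuple_exists_prod_mul_prod_eq`;
§5 the HEAD **`exists_preimage_neg_brillNoetherLocus_eq`**.  COUNT-NEUTRAL.  HC_CM is proved only modulo the 7 printed citations until
rung 0 closes; this file moves no book by itself.

Ed. 2 (§6, append-only): with Abel's theorem now ★ (`Jacobian.ajSum_congr_linEquiv`, `Motives/AbelTheorem`) the hypothesis `hlin` is
discharged (`exists_preimage_neg_brillNoetherLocus_eq_of_isSmoothProjective`), and halving `κ` in the divisible group `J(ℂ)` (★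
`AbelianVariety.exists_pow_eq`) gives **a SYMMETRIC translate of `W̃_{g−1}`**: `[−1]⁻¹(t_{κ′}⁻¹ W̃_{g−1}) = t_{κ′}⁻¹ W̃_{g−1}` for some `κ′`
(`exists_translate_brillNoetherLocus_symmetric`; Lange Thm. 4.2.5: `W_{g−1} − κ` is symmetric for a theta characteristic `κ`).

## References
* [Lange2023AbelianVarietiesComplex] H. Lange, *Abelian Varieties over the Complex Numbers* (2023), §4.2.1 (`W̃_n = α_{nc}(C^{(n)})`),
  §4.2.2 Thm. 4.2.5 (Riemann's theorem; `K_C − D` effective for `D ∈ W_{g−1}`).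
* [Milne1986JacobianVarieties] J. S. Milne, *Jacobian Varieties* (1986), §5 (the maps `f^r`, `W^r`), §6.
* [Hartshorne1977] R. Hartshorne, *Algebraic Geometry* (1977), IV.1 Thm. 1.3 (Riemann–Roch), II.6 (divisors on curves).
* [GortzWedhorn2023] U. Görtz, T. Wedhorn, *Algebraic Geometry II* (2023), Lemma 24.65 (p. 405).
-/

set_option autoImplicit false

noncomputable section

open CategoryTheory AlgebraicGeometry

universe u

namespace Literature.AlgebraicGeometry.Motives

namespace Jacobian

open CartierDivisor CurvePlaces Literature.AlgebraicGeometry.HodgeTheory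
open Literature.NumberTheory.DiophantineGeometry Literature.NumberTheory.DiophantineGeometry.AlgFunctionField
open scoped MonObj

variable {C : SchemeOver ℂ} [IsIntegral C.left] [SmoothOfRelativeDimension 1 C.hom] [IsProper C.hom]

/-! ## §1 `aj_P` of a sum of points -/

/-- **`aj_P(Σᵢ [τᵢ]) = ∏ᵢ f^P(τᵢ)`** for a tuple `τ` of complex points of the smooth proper curve `C` (additivity of `aj` and the
normalisation `aj_P([Q]) = f^P(Q)`, ★ `ajSum_add`, `ajSum_pointDivisor`). [cite: Milne1986JacobianVarieties, §5 (the maps f^r : C^r → J)] -/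
theorem ajSum_sumDivisor_pointDivisor (𝒥 : Jacobian C) (P : AlgPoints C ℂ) :
    {r : ℕ} → (τ : Fin r → AlgPoints C ℂ) →
      𝒥.ajSum P (sumDivisor fun i => pointDivisor C (pt_ne_genericPoint C (τ i))) = ∏ i, τ i ≫ 𝒥.abelJacobi P
  | 0, τ => by rw [sumDivisor_zero, ajSum_zero, Fin.prod_univ_zero]
  | r + 1, τ => by
    haveI : LocallyOfFiniteType C.hom := locallyOfFiniteType_of_smoothCurve C
    rw [sumDivisor_succ, ajSum_add, ajSum_pointDivisor, AlgPoints.map_apply, Fin.prod_univ_succ,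
      ajSum_sumDivisor_pointDivisor 𝒥 P (fun i => τ i.succ)]

/-! ## §2 The function-field divisor of a sum of points -/

omit [IsProper C.hom] in
/-- `place` does not depend on the proof that the point is not generic (for rewriting under the binder). [folklore] -/
private theorem place_congr {x y : C.left} (hx : x ≠ genericPoint C.left) (hy : y ≠ genericPoint C.left) (h : x = y) :
    place C x hx = place C y hy := by
  subst h; rfl

/-- **`toDivisor (Σᵢ [τᵢ]) = Σᵢ 1·(place τᵢ)`**: the divisor of `ℂ(C)/ℂ` of a sum of points is the sum of their places (★
`toDivisor_sumDivisor`, `toDivisor_pointDivisor`). [cite: Hartshorne1977, II.6 Cor. 6.6 and Prop. 6.11] -/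
theorem toDivisor_sumDivisor_pointDivisor {r : ℕ} (τ : Fin r → AlgPoints C ℂ) :
    toDivisor C (sumDivisor fun i => pointDivisor C (pt_ne_genericPoint C (τ i))) =
      ∑ i, Finsupp.single (place C (τ i).pt (pt_ne_genericPoint C (τ i))) 1 := by
  rw [toDivisor_sumDivisor]
  exact Finset.sum_congr rfl fun i _ => toDivisor_pointDivisor (pt_ne_genericPoint C (τ i))

/-- The divisor of `ℂ(C)/ℂ` of a sum of points is effective. [folklore] -/
private theorem toDivisor_sumDivisor_pointDivisor_nonneg {r : ℕ} (τ : Fin r → AlgPoints C ℂ) :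
    0 ≤ toDivisor C (sumDivisor fun i => pointDivisor C (pt_ne_genericPoint C (τ i))) := by
  rw [toDivisor_sumDivisor_pointDivisor]
  exact Finset.sum_nonneg fun i _ => Finsupp.single_nonneg.mpr zero_le_one

/-- The divisor of `ℂ(C)/ℂ` of a sum of `r` complex points has degree `r` (every place of `ℂ(C)/ℂ` has degree one).
[cite: Hartshorne1977, II.6 (degree of a divisor on a curve)] -/
theorem degree_toDivisor_sumDivisor_pointDivisor {r : ℕ} (τ : Fin r → AlgPoints C ℂ) :
    Divisor.degree (toDivisor C (sumDivisor fun i => pointDivisor C (pt_ne_genericPoint C (τ i)))) = r := by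
  rw [toDivisor_sumDivisor_pointDivisor, map_sum]
  simp only [Divisor.degree_single, PlaceOver.degree_eq_one_of_isAlgClosed', Nat.cast_one, mul_one,
    Finset.sum_const, Finset.card_univ, Fintype.card_fin, nsmul_eq_mul]

/-- The Cartier degree of a sum of `r` complex points is `r`. [cite: Hartshorne1977, II.6 (degree of a divisor on a curve)] -/
theorem degree_sumDivisor_pointDivisor {r : ℕ} (τ : Fin r → AlgPoints C ℂ) :
    CartierDivisor.degree C (sumDivisor fun i => pointDivisor C (pt_ne_genericPoint C (τ i))) = r := by
  rw [← degree_toDivisor, degree_toDivisor_sumDivisor_pointDivisor]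

/-- **Every effective divisor of degree `r` of `ℂ(C)/ℂ` is the divisor of a sum of `r` complex points of `C`**: it is a sum of `r`
places (★ `Divisor.exists_eq_sum_single_of_nonneg`), a place is the place of its centre, a closed point, and closed points of `C` are
complex points (Nullstellensatz, ★ `ComplexPoints.range_pt`). [cite: Hartshorne1977, II.6 Cor. 6.6 and Prop. 6.11] -/
theorem exists_tuple_toDivisor_sumDivisor_eq {r : ℕ} (A : Divisor ℂ C.left.functionField) (hA : 0 ≤ A)
    (hdeg : Divisor.degree A = r) :
    ∃ τ : Fin r → AlgPoints C ℂ, toDivisor C (sumDivisor fun i => pointDivisor C (pt_ne_genericPoint C (τ i))) = A := by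
  haveI : LocallyOfFiniteType C.hom := locallyOfFiniteType_of_smoothCurve C
  obtain ⟨v, rfl⟩ := Divisor.exists_eq_sum_single_of_nonneg r A hA hdeg
  -- the centre of each place is a closed point, hence a complex point
  have hτ : ∀ j : Fin r, ∃ Q : AlgPoints C ℂ, Q.pt = pointOfPlace (C := C) (v j) := fun j => by
    have hcl : pointOfPlace (C := C) (v j) ∈ closedPoints C.left :=
      mem_closedPoints_iff.mpr (isClosed_singleton C (pointOfPlace_ne_genericPoint (v j)))
    rw [← ComplexPoints.range_pt] at hcl
    exact hcl
  choose τ hτ using hτ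
  refine ⟨τ, ?_⟩
  rw [toDivisor_sumDivisor_pointDivisor]
  refine Finset.sum_congr rfl fun j _ => ?_
  congr 1
  rw [place_congr (pt_ne_genericPoint C (τ j)) (pointOfPlace_ne_genericPoint (v j)) (hτ j), place_pointOfPlace]

/-! ## §3 Linear equivalence of Cartier divisors from linear equivalence of their function-field divisors -/

/-- **`toDivisor D ∼ toDivisor E ⇒ D ∼ E`** on the smooth complete curve: if `toDivisor D − toDivisor E = div(x)`, then `x⁻¹` is a
nonzero section of `𝒪(D − E)` and `x` one of `𝒪(E − D)` (`Γ(C, 𝒪(D)) = L(toDivisor D)`, ★ `sections_eq_riemannRochSpace`), so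
`D ∼ E` by Görtz–Wedhorn II Lemma 24.65 (★ `linEquiv_of_isSection_sub`).  The converse is ★ `LinEquiv.toDivisor_isLinearlyEquivalent`.
[cite: GortzWedhorn2023, Lemma 24.65 (p. 405)] [cite: Hartshorne1977, II.6 Prop. 6.11] -/
theorem linEquiv_of_isLinearlyEquivalent_toDivisor {D E : CartierDivisor C.left}
    (h : Divisor.IsLinearlyEquivalent (toDivisor C D) (toDivisor C E)) : D.LinEquiv E := by
  obtain ⟨x, hx0, hx⟩ := h
  haveI : UniversallyClosed (C.left ↘ Spec (.of ℂ)) := ‹IsProper C.hom›.toUniversallyClosed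
  have hs : (D + -E).IsSection x⁻¹ := by
    rw [← mem_sections_iff (K := ℂ), sections_eq_riemannRochSpace, toDivisor_add, toDivisor_neg,
      mem_riemannRochSpace_iff_nonneg _ (inv_ne_zero hx0), principalDivisor_inv hx0, hx]
    rw [show -(toDivisor C D - toDivisor C E) + (toDivisor C D + -toDivisor C E) = 0 by abel]
  have ht : (E + -D).IsSection x := by
    rw [← mem_sections_iff (K := ℂ), sections_eq_riemannRochSpace, toDivisor_add, toDivisor_neg,
      mem_riemannRochSpace_iff_nonneg _ hx0, hx]
    rw [show toDivisor C D - toDivisor C E + (toDivisor C E + -toDivisor C D) = 0 by abel]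
  exact linEquiv_of_isSection_sub ℂ (inv_ne_zero hx0) hs hx0 ht

/-! ## §4 The Riemann–Roch step and the key lemma -/

/-- `ℓ(A) ≥ 1` for an effective divisor `A` of the function field `ℂ(C)/ℂ` (the constants lie in `L(A) ⊇ L(0)`). [folklore] -/
private theorem ell_pos_of_nonneg (A : Divisor ℂ C.left.functionField) (hA : 0 ≤ A) : 0 < ell A := by
  haveI := finiteDimensional_riemannRochSpace_of_isAlgFunctionField (K := ℂ) A
  refine Module.finrank_pos_iff_exists_ne_zero.mpr ⟨⟨algebraMap ℂ _ 1, ?_⟩, ?_⟩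
  · exact riemannRochSpace_mono hA (algebraMap_mem_riemannRochSpace_zero 1)
  · intro h
    have h1 : (algebraMap ℂ C.left.functionField 1) = 0 := congrArg Subtype.val h
    rw [map_one] at h1
    exact one_ne_zero h1

/-- **The Riemann–Roch step.**  For a canonical divisor `W` of `ℂ(C)/ℂ` satisfying Riemann–Roch and a sum `D = Σ_{i<r}[τᵢ]` of
`r = g − 1` points (`g ≥ 1` the genus), `ℓ(W − D) = h⁰(D) ≥ 1`: there is `y ≠ 0` with `div(y) + W − D ≥ 0`.
[cite: Hartshorne1977, IV.1 Thm. 1.3 (Riemann–Roch)] [cite: Lange2023AbelianVarietiesComplex, §4.2.2 Thm. 4.2.5] -/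
theorem exists_nonneg_principalDivisor_add_canonical_sub [GeometricallyIntegral C.hom] {r : ℕ} (hg : curveGenus C = r + 1)
    {W : Divisor ℂ C.left.functionField}
    (hRR : ∀ D : CartierDivisor C.left, (D.h0 ℂ : ℤ) =
      CartierDivisor.degree C D + 1 - curveGenus C + ell (W - toDivisor C D))
    (τ : Fin r → AlgPoints C ℂ) :
    ∃ y : C.left.functionField, y ≠ 0 ∧
      0 ≤ principalDivisor ℂ y + (W - toDivisor C (sumDivisor fun i => pointDivisor C (pt_ne_genericPoint C (τ i)))) := by
  set D : CartierDivisor C.left := sumDivisor fun i => pointDivisor C (pt_ne_genericPoint C (τ i)) with hD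
  have h0 : 0 < ell (W - toDivisor C D) := by
    have h := hRR D
    rw [degree_sumDivisor_pointDivisor, hg, h0_eq_ell] at h
    have h1 := ell_pos_of_nonneg (toDivisor C D) (toDivisor_sumDivisor_pointDivisor_nonneg τ)
    push_cast at h
    omega
  haveI := finiteDimensional_riemannRochSpace_of_isAlgFunctionField (K := ℂ) (W - toDivisor C D)
  obtain ⟨y, hy⟩ := Module.finrank_pos_iff_exists_ne_zero.mp h0
  have hy0 : (y : C.left.functionField) ≠ 0 := fun h => hy (Subtype.ext h)
  exact ⟨y, hy0, (mem_riemannRochSpace_iff_nonneg _ hy0).mp y.2⟩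

/-- **The key lemma (Riemann–Roch + Abel).**  On a smooth projective complex curve of genus `g = r + 1`, assuming Abel's theorem in
the form `D ∼ E → aj_P(D) = aj_P(E)`, there is `κ ∈ J(ℂ)` such that for every `r`-tuple `τ` of complex points there is an `r`-tuple `τ′`
with `(∏ᵢ f^P(τ′ᵢ)) · (∏ᵢ f^P(τᵢ)) = κ`: `Σ[τ′ᵢ] ∼ K_C − Σ[τᵢ]` by Riemann–Roch, and all the sums `Σ[τ′ᵢ] + Σ[τᵢ] ∼ K_C` have the
same `aj_P`, namely `κ = [K_C − (2g − 2)P]`. [cite: Lange2023AbelianVarietiesComplex, §4.2.2 Thm. 4.2.5] [cite: Hartshorne1977, IV.1 Thm. 1.3 (Riemann–Roch)] -/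
theorem exists_forall_tuple_exists_prod_mul_prod_eq [GeometricallyIntegral C.hom] (𝒥 : Jacobian C) (P : AlgPoints C ℂ)
    (hlin : ∀ D E : CartierDivisor C.left, D.LinEquiv E → 𝒥.ajSum P D = 𝒥.ajSum P E)
    {r : ℕ} (hg : curveGenus C = r + 1) :
    ∃ κ : 𝒥.J.Points ℂ, ∀ τ : Fin r → AlgPoints C ℂ, ∃ τ' : Fin r → AlgPoints C ℂ,
      (∏ i, τ' i ≫ 𝒥.abelJacobi P) * (∏ i, τ i ≫ 𝒥.abelJacobi P) = κ := by
  obtain ⟨W, hW, hRR⟩ := riemannRoch (K := ℂ) C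
  -- the Riemann–Roch partner of a tuple
  have hpartner : ∀ τ : Fin r → AlgPoints C ℂ, ∃ (y : C.left.functionField) (τ' : Fin r → AlgPoints C ℂ), y ≠ 0 ∧
      toDivisor C (sumDivisor fun i => pointDivisor C (pt_ne_genericPoint C (τ' i))) =
        principalDivisor ℂ y + (W - toDivisor C (sumDivisor fun i => pointDivisor C (pt_ne_genericPoint C (τ i)))) := by
    intro τ
    obtain ⟨y, hy0, hy⟩ := exists_nonneg_principalDivisor_add_canonical_sub hg hRR τ
    have hdeg : Divisor.degree (principalDivisor ℂ y +
        (W - toDivisor C (sumDivisor fun i => pointDivisor C (pt_ne_genericPoint C (τ i))))) = r := by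
      have hg' : (genus ℂ C.left.functionField : ℤ) = r + 1 := by
        unfold curveGenus at hg; exact_mod_cast hg
      rw [map_add, map_sub, degree_principalDivisor_eq_zero hy0, hW.1, degree_toDivisor_sumDivisor_pointDivisor, hg']
      ring
    obtain ⟨τ', hτ'⟩ := exists_tuple_toDivisor_sumDivisor_eq _ hy hdeg
    exact ⟨y, τ', hy0, hτ'⟩
  choose y τ' hy0 hτ' using hpartner
  -- the reference pair
  let τ₀ : Fin r → AlgPoints C ℂ := fun _ => P
  refine ⟨(∏ i, τ' τ₀ i ≫ 𝒥.abelJacobi P) * (∏ i, τ₀ i ≫ 𝒥.abelJacobi P), fun τ => ⟨τ' τ, ?_⟩⟩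
  -- the two total divisors differ by `div(y τ / y τ₀)`
  have hlinEq : (sumDivisor (fun i => pointDivisor C (pt_ne_genericPoint C (τ' τ i))) +
      sumDivisor (fun i => pointDivisor C (pt_ne_genericPoint C (τ i)))).LinEquiv
      (sumDivisor (fun i => pointDivisor C (pt_ne_genericPoint C (τ' τ₀ i))) +
        sumDivisor (fun i => pointDivisor C (pt_ne_genericPoint C (τ₀ i)))) := by
    refine linEquiv_of_isLinearlyEquivalent_toDivisor ⟨y τ * (y τ₀)⁻¹, mul_ne_zero (hy0 τ) (inv_ne_zero (hy0 τ₀)), ?_⟩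
    rw [principalDivisor_mul (hy0 τ) (inv_ne_zero (hy0 τ₀)), principalDivisor_inv (hy0 τ₀), toDivisor_add, toDivisor_add,
      hτ' τ, hτ' τ₀]
    abel
  have h := hlin _ _ hlinEq
  rwa [ajSum_add, ajSum_add, ajSum_sumDivisor_pointDivisor, ajSum_sumDivisor_pointDivisor, ajSum_sumDivisor_pointDivisor,
    ajSum_sumDivisor_pointDivisor] at h

/-! ## §5 The HEAD: `[−1]⁻¹ W̃_{g−1}(P) = t_κ⁻¹ W̃_{g−1}(P)` -/

omit [IsIntegral C.left] [SmoothOfRelativeDimension 1 C.hom] [IsProper C.hom] in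
/-- **`W̃_{g−1}(P)` is symmetric up to a translation (letter (SYM)).**  For a smooth projective complex curve `C`, a Jacobian `𝒥`
(`g = dim J`), `P ∈ C(ℂ)`, and granting Abel's theorem `D ∼ E → aj_P(D) = aj_P(E)` (letter (g4-1e)), there is `κ ∈ J(ℂ)` with
**`[−1]⁻¹ W̃_{g−1}(P) = t_κ⁻¹ W̃_{g−1}(P)`** as subsets of `J` — i.e. `−W̃_{g−1} = W̃_{g−1} − κ`, `κ = [K_C − (2g−2)P]`: on complex points
`x⁻¹ ∈ W̃ ⟺ κ·x ∈ W̃` by the key lemma (Riemann–Roch: `K_C − D` is effective for `D` effective of degree `g − 1`), and closed subsets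
of `J` with the same complex points coincide. (Print: `(−1)^*W_{g−1} = W_{g−1}` in `Pic^{g−1}(C)`, the first step of Riemann's
theorem on symmetric theta divisors.) [cite: Lange2023AbelianVarietiesComplex, §4.2.2 Thm. 4.2.5] [cite: Milne1986JacobianVarieties, §5 (the maps f^r : C^r → J)] -/
theorem exists_preimage_neg_brillNoetherLocus_eq {C : SchemeOver ℂ} [IsIntegral C.left] [IsLocallyNoetherian C.left]
    (𝒥 : Jacobian C) (hC : IsSmoothProjective 1 C) (P : AlgPoints C ℂ)
    (hlin : ∀ D E : CartierDivisor C.left, D.LinEquiv E → 𝒥.ajSum P D = 𝒥.ajSum P E) :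
    ∃ κ : 𝒥.J.Points ℂ,
      (AbelianVariety.Hom.toSchemeHom ((-1 : ℤ) • 𝟙 𝒥.J)).base ⁻¹' 𝒥.brillNoetherLocus P (𝒥.J.dim - 1) =
        (𝒥.J.translation κ).left.base ⁻¹' 𝒥.brillNoetherLocus P (𝒥.J.dim - 1) := by
  haveI := hC.smoothOfRelativeDimension
  haveI : IsProper C.hom := IsSmoothProjective.isProper_holds hC
  haveI : GeometricallyIntegral C.hom := IsSmoothProjective.geometricallyIntegral_holds hC
  -- `g = dim J`
  have hg : curveGenus C = 𝒥.J.dim :=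
    le_antisymm (curveGenus_le_jacobian_dim C hC.isProjectiveOver 𝒥) (Jacobian.dim_le_curveGenus C hC 𝒥)
  -- the pointwise statement: `∃ κ, ∀ a ∈ W̃(ℂ), κ · a⁻¹ ∈ W̃(ℂ)`
  have hS : ∃ κ : 𝒥.J.Points ℂ, ∀ a : 𝒥.J.Points ℂ,
      (∃ τ : Fin (𝒥.J.dim - 1) → AlgPoints C ℂ, (∏ i, τ i ≫ 𝒥.abelJacobi P) = a) →
        ∃ τ' : Fin (𝒥.J.dim - 1) → AlgPoints C ℂ, (∏ i, τ' i ≫ 𝒥.abelJacobi P) = κ * a⁻¹ := by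
    rcases Nat.eq_zero_or_pos 𝒥.J.dim with h0 | hpos
    · -- `g = 0`: `W̃_0 = {0}`, `κ = 1`
      refine ⟨1, fun a ⟨τ, hτ⟩ => ⟨τ, ?_⟩⟩
      have hr : 𝒥.J.dim - 1 = 0 := by omega
      have h1 : (∏ i, τ i ≫ 𝒥.abelJacobi P) = 1 := by
        rw [Finset.prod_eq_one]
        intro i _
        exact (Fin.cast hr i).elim0
      rw [← hτ, h1, inv_one, mul_one]
    · obtain ⟨κ, hκ⟩ := exists_forall_tuple_exists_prod_mul_prod_eq 𝒥 P hlin (r := 𝒥.J.dim - 1) (by omega)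
      refine ⟨κ, fun a ⟨τ, hτ⟩ => ?_⟩
      obtain ⟨τ', hτ'⟩ := hκ τ
      refine ⟨τ', ?_⟩
      rw [← hτ, ← hτ']
      group
  obtain ⟨κ, hκ⟩ := hS
  refine ⟨κ, ?_⟩
  -- both sides are closed; compare complex points
  refine eq_of_isClosed_of_forall_pt_mem_iff
    ((𝒥.isClosed_brillNoetherLocus P _).preimage (Scheme.Hom.continuous _))
    ((𝒥.isClosed_brillNoetherLocus P _).preimage (Scheme.Hom.continuous _)) fun Q => ?_
  have h1 : (AbelianVariety.Hom.toSchemeHom ((-1 : ℤ) • 𝟙 𝒥.J)).base Q.pt = AlgPoints.pt (Q⁻¹) := by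
    rw [← AbelianVariety.comp_zsmulPt_neg_one]; rfl
  have h2 : (𝒥.J.translation κ).left.base Q.pt = AlgPoints.pt (κ * Q) := 𝒥.J.translation_apply_pt Q κ
  rw [Set.mem_preimage, Set.mem_preimage, h1, h2, pt_mem_brillNoetherLocus_iff, pt_mem_brillNoetherLocus_iff]
  constructor
  · intro h
    obtain ⟨τ', hτ'⟩ := hκ _ h
    exact ⟨τ', by rw [hτ', inv_inv]⟩
  · intro h
    obtain ⟨τ', hτ'⟩ := hκ _ h
    refine ⟨τ', ?_⟩
    rw [hτ', mul_inv_rev, mul_comm Q⁻¹, ← mul_assoc, mul_inv_cancel, one_mul]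

/-! ## §6 (ed. 2) Unconditional form and a symmetric translate of `W̃_{g−1}` -/

/-- **(SYM) unconditionally**: for a smooth projective complex curve, a Jacobian `𝒥` and `P ∈ C(ℂ)` there is `κ ∈ J(ℂ)` with
`[−1]⁻¹ W̃_{g−1}(P) = t_κ⁻¹ W̃_{g−1}(P)` — §5 with Abel's theorem ★ `Jacobian.ajSum_congr_linEquiv` discharging `hlin`.
[cite: Lange2023AbelianVarietiesComplex, §4.2.2 Thm. 4.2.5] [cite: Lange2023AbelianVarietiesComplex, §4.1.3 Thm. 4.1.4 (p. 206)] -/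
theorem exists_preimage_neg_brillNoetherLocus_eq_of_isSmoothProjective {C : SchemeOver ℂ} (𝒥 : Jacobian C)
    (hC : IsSmoothProjective 1 C) (P : AlgPoints C ℂ) :
    ∃ κ : 𝒥.J.Points ℂ,
      (AbelianVariety.Hom.toSchemeHom ((-1 : ℤ) • 𝟙 𝒥.J)).base ⁻¹' 𝒥.brillNoetherLocus P (𝒥.J.dim - 1) =
        (𝒥.J.translation κ).left.base ⁻¹' 𝒥.brillNoetherLocus P (𝒥.J.dim - 1) := by
  haveI : IsIntegral C.left := IsSmoothProjective.isIntegral_holds hC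
  haveI := hC.smoothOfRelativeDimension
  haveI : IsProper C.hom := IsSmoothProjective.isProper_holds hC
  exact 𝒥.exists_preimage_neg_brillNoetherLocus_eq hC P fun D E h => 𝒥.ajSum_congr_linEquiv P h

/-- **A symmetric translate of `W̃_{g−1}` exists** (Riemann; Lange Thm. 4.2.5 «`W_{g−1} = α_κ^*Θ` with `Θ` symmetric, `κ` a theta
characteristic»; Mumford's symmetric theta divisor): there is `κ′ ∈ J(ℂ)` with **`[−1]⁻¹(t_{κ′}⁻¹ W̃_{g−1}(P)) = t_{κ′}⁻¹ W̃_{g−1}(P)`**.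
Take `κ′` with `κ′² = κ` (`J(ℂ)` is divisible, ★ `AbelianVariety.exists_pow_eq`) for the `κ` of (SYM): on complex points
`κ′·x⁻¹ ∈ W̃ ⟺ κ·(κ′⁻¹x) ∈ W̃ ⟺ κ′·x ∈ W̃`, and closed subsets with the same complex points coincide.
[cite: Lange2023AbelianVarietiesComplex, §4.2.2 Thm. 4.2.5] [cite: Milne1986AbelianVarieties, Thm. 8.2] -/
theorem exists_translate_brillNoetherLocus_symmetric {C : SchemeOver ℂ} (𝒥 : Jacobian C)
    (hC : IsSmoothProjective 1 C) (P : AlgPoints C ℂ) :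
    ∃ κ' : 𝒥.J.Points ℂ,
      (AbelianVariety.Hom.toSchemeHom ((-1 : ℤ) • 𝟙 𝒥.J)).base ⁻¹'
          ((𝒥.J.translation κ').left.base ⁻¹' 𝒥.brillNoetherLocus P (𝒥.J.dim - 1)) =
        (𝒥.J.translation κ').left.base ⁻¹' 𝒥.brillNoetherLocus P (𝒥.J.dim - 1) := by
  haveI : IsProper C.hom := IsSmoothProjective.isProper_holds hC
  obtain ⟨κ, hκ⟩ := 𝒥.exists_preimage_neg_brillNoetherLocus_eq_of_isSmoothProjective hC P
  obtain ⟨κ', hκ'⟩ := 𝒥.J.exists_pow_eq two_ne_zero κ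
  refine ⟨κ', ?_⟩
  -- the action of `[-1]` and `t_a` on complex points
  have hneg : ∀ Q : 𝒥.J.Points ℂ,
      (AbelianVariety.Hom.toSchemeHom ((-1 : ℤ) • 𝟙 𝒥.J)).base Q.pt = AlgPoints.pt (Q⁻¹) := fun Q => by
    rw [← AbelianVariety.comp_zsmulPt_neg_one]; rfl
  have htr : ∀ a Q : 𝒥.J.Points ℂ, (𝒥.J.translation a).left.base Q.pt = AlgPoints.pt (a * Q) := fun a Q =>
    𝒥.J.translation_apply_pt Q a
  -- (SYM) read on complex points: `x⁻¹ ∈ W̃ ⟺ κ·x ∈ W̃`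
  have hpt : ∀ x : 𝒥.J.Points ℂ, AlgPoints.pt (x⁻¹) ∈ 𝒥.brillNoetherLocus P (𝒥.J.dim - 1) ↔
      AlgPoints.pt (κ * x) ∈ 𝒥.brillNoetherLocus P (𝒥.J.dim - 1) := fun x => by
    have h := Set.ext_iff.mp hκ x.pt
    rwa [Set.mem_preimage, Set.mem_preimage, hneg, htr] at h
  refine eq_of_isClosed_of_forall_pt_mem_iff
    (((𝒥.isClosed_brillNoetherLocus P _).preimage (Scheme.Hom.continuous _)).preimage (Scheme.Hom.continuous _))
    ((𝒥.isClosed_brillNoetherLocus P _).preimage (Scheme.Hom.continuous _)) fun Q => ?_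
  rw [Set.mem_preimage, Set.mem_preimage, Set.mem_preimage, hneg, htr, htr]
  -- `κ′·Q⁻¹ = (κ′⁻¹·Q)⁻¹` and `κ·(κ′⁻¹·Q) = κ′·Q`
  have h1 : κ' * Q⁻¹ = (κ'⁻¹ * Q)⁻¹ := by rw [mul_inv_rev, inv_inv, mul_comm]
  have h2 : κ * (κ'⁻¹ * Q) = κ' * Q := by
    rw [← hκ', pow_two, ← mul_assoc, mul_assoc κ' κ' κ'⁻¹, mul_inv_cancel, mul_one]
  rw [h1, hpt, h2]

end Jacobian

end Literature.AlgebraicGeometry.Motives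

end
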